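import Literature.Probability.LatticeModels.IsingFieldUniqueness
import HarnessLib

/-!
# Absence of phase coexistence from a Lipschitz bound on the `+` magnetisation in an auxiliary
# field (the Lee–Yang substitute for the GHS step of `IsingFieldUniqueness`)

Topic `Probability/LatticeModels`; continues `IsingFieldUniqueness.lean`. There, for a periodic
system in the field `s₀·v`, the equality `m⁺_c = m⁻_c` was proved at the sites `c` CARRYING the
field (`v_c > 0`), the only analytic input beyond convexity being the GHS concavity of
`s ↦ ⟨σ_c⟩⁺_Λ(s·v)`, used for its consequence "`M⁺(s) → M⁺(s₀)` as `s ↑ s₀`". Here the same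
conclusion is obtained at the sites `c` carrying an AUXILIARY field direction `u ≥ 0` (`u_c > 0`),
the deformation being `s₀v + λu` around `λ = 0`, from the hypothesis that the `+` boundary
condition sums `∑_{k∈Λₙ} u_k ⟨σ_k⟩⁺_{Λₙ}` are LIPSCHITZ in `λ ∈ [-δ, 0]` uniformly in the volume
(`≤ C · #Bₙ · |λ|` on the tiled volumes `Λₙ`). That hypothesis is what a uniform Lee–Yang
zero-free disc in the activity `e^{-2βλ}` delivers (`LeeYangLipschitz.lean`); it lets the field
direction `u` be supported where the actual field `s₀v` VANISHES, which the GHS route cannot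
reach (Friedli–Velenik 2017, Remark 3.41, is about `h ≠ 0`). The scheme is the finite-volume form
of "the pressure is differentiable in `λ` at `0`, hence `∂ψ/∂λ⁺ = ∂ψ/∂λ⁻`, i.e. `M⁺ = M⁻`"
(Friedli–Velenik 2017, Theorem 3.34 and Prop. 3.29; Lebowitz–Martin-Löf 1972):

* `log_fieldZ_affCpl_sub_mem_Icc`, `sum_fieldExpect_affCpl_plus_sub_minus_le` — the convexity /
  surface inequality of `IsingFieldUniqueness.sumPlusMag_sub_sumMinusMag_le` along a general affine
  field path `b + λu`: for `λ < 0`,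
  `∑_k u_k ⟨σ_k⟩⁺_{Λ;b+λu} - ∑_k u_k ⟨σ_k⟩⁻_{Λ;b} ≤ 4|∂ᵉΛ|/|λ|`.
* `exists_volume_plusMag_sub_minusMag_le_of_lipschitz` — under the tiling / van Hove hypotheses
  of `IsingFieldUniqueness.exists_volume_plusMag_sub_minusMag_le`, periodicity of `v` and `u ≥ 0`,
  and the Lipschitz hypothesis, for every cell site `c` with `u_c > 0` and `ε > 0` there is a
  finite `Λ₀` with `⟨σ_c⟩⁺_{Λ;s₀v} - ⟨σ_c⟩⁻_{Λ;s₀v} ≤ ε` for all `Λ ⊇ Λ₀`.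

## References

* S. Friedli, Y. Velenik, *Statistical Mechanics of Lattice Systems* (CUP 2017), Prop. 3.29,
  Theorem 3.34, Remark 3.41, Theorem 3.42 [FriedliVelenik2017].
* J. L. Lebowitz, A. Martin-Löf, *On the uniqueness of the equilibrium state for Ising spin
  systems*, Comm. Math. Phys. 25 (1972) 276–282.
* T. D. Lee, C. N. Yang, Phys. Rev. 87 (1952) 410–419 [LeeYang1952].
-/

noncomputable section

open MeasureTheory Finset Set Filter Topology

namespace Literature.Probability.LatticeModels

variable {V : Type*} (G : SimpleGraph V) [DecidableEq V] [G.LocallyFinite] (β : ℝ) (v : V → ℝ)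

variable {G β v}

/-! ### The convexity / surface inequality along a general affine field path -/

/-- **Mean-value bound along `b + tu`**: for `t < t'` and a fixed boundary condition,
`β(t'-t)⟨U⟩_{Λ;b+tu} ≤ log Z_{Λ;b+t'u} - log Z_{Λ;b+tu} ≤ β(t'-t)⟨U⟩_{Λ;b+t'u}`, `U = ∑ u_kσ_k`
(the derivative `β⟨U⟩` of `log Z` is nondecreasing; Friedli–Velenik 2017, Lemma 3.5).
[cite: FriedliVelenik2017, Lemma 3.5 and Theorem 3.34 (proof)] -/
theorem log_fieldZ_affCpl_sub_mem_Icc (hβ : 0 ≤ β) (Λ : Finset V) (b u : V → ℝ) (η : SpinConfig V)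
    {t t' : ℝ} (htt' : t < t') :
    Real.log (fieldZ G Λ β (affCpl b u t') (.fixed η)) -
        Real.log (fieldZ G Λ β (affCpl b u t) (.fixed η)) ∈
      Set.Icc (β * (t' - t) * fieldExpect G Λ β (affCpl b u t) (.fixed η) (raySpin Λ u))
        (β * (t' - t) * fieldExpect G Λ β (affCpl b u t') (.fixed η) (raySpin Λ u)) := by
  set F : ℝ → ℝ := fun s => Real.log (fieldZ G Λ β (affCpl b u s) (.fixed η)) with hF
  set D : ℝ → ℝ := fun s => β * fieldExpect G Λ β (affCpl b u s) (.fixed η) (raySpin Λ u) with hD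
  have hderiv : ∀ s, HasDerivAt F (D s) s := fun s => hasDerivAt_log_fieldZ_ray G Λ β b u _ s
  obtain ⟨ξ, hξ, hslope⟩ := exists_hasDerivAt_eq_slope F D htt'
    (fun s _ => (hderiv s).continuousAt.continuousWithinAt) (fun s _ => hderiv s)
  have hmono := monotone_fieldExpect_raySpin_ray G hβ Λ b u (.fixed η)
  have hpos : 0 < t' - t := sub_pos.2 htt'
  have hkey : F t' - F t = (t' - t) * D ξ := by
    rw [hslope]; field_simp
  change F t' - F t ∈ Set.Icc (β * (t' - t) * _) (β * (t' - t) * _)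
  rw [hkey, hD]
  constructor
  · have := hmono (le_of_lt hξ.1)
    nlinarith [mul_le_mul_of_nonneg_left this hβ]
  · have := hmono (le_of_lt hξ.2)
    nlinarith [mul_le_mul_of_nonneg_left this hβ]

/-- **The finite-volume inequality across the boundary condition, along `b + λu`**: for `β > 0`
and `λ < 0`, `∑_k u_k ⟨σ_k⟩⁺_{Λ;b+λu} - ∑_k u_k ⟨σ_k⟩⁻_{Λ;b} ≤ 4|∂ᵉΛ|/(-λ)` — the mean-value bounds
for the `+` state at `λ` and the `-` state at `0` combined with `|log Z⁺_Λ - log Z⁻_Λ| ≤ 2β|∂ᵉΛ|`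
(`abs_log_fieldZ_fixed_sub_le`); the finite-volume shadow of `∂ψ/∂λ⁺(λ) ≤ ∂ψ/∂λ⁻(0)`.
[cite: FriedliVelenik2017, Theorem 3.34 (proof) and §3.2.1 (proof of Theorem 3.6)] -/
theorem sum_fieldExpect_affCpl_plus_sub_minus_le (hβ : 0 < β) (Λ : Finset V) (b u : V → ℝ)
    {l : ℝ} (hl : l < 0) :
    ∑ k ∈ Λ, u k * fieldExpect G Λ β (affCpl b u l) .plus (spinAt k) -
        ∑ k ∈ Λ, u k * fieldExpect G Λ β b .minus (spinAt k) ≤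
      4 * (edgeBoundary G Λ).card / (-l) := by
  have hpos : 0 < -l := neg_pos.2 hl
  rw [sum_mul_fieldExpect_spinAt (G := G) (β := β) (v := u),
    sum_mul_fieldExpect_spinAt (G := G) (β := β) (v := u)]
  set Sp := fieldExpect G Λ β (affCpl b u l) .plus (raySpin Λ u)
  set Sm := fieldExpect G Λ β b .minus (raySpin Λ u)
  have hplus := (log_fieldZ_affCpl_sub_mem_Icc (G := G) hβ.le Λ b u 1 hl).1
  have hminus := (log_fieldZ_affCpl_sub_mem_Icc (G := G) hβ.le Λ b u (-1) hl).2
  rw [affCpl_zero] at hplus hminus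
  change β * (0 - l) * Sp ≤ _ at hplus
  change _ ≤ β * (0 - l) * Sm at hminus
  rw [zero_sub] at hplus hminus
  have hb1 := abs_log_fieldZ_fixed_sub_le G hβ.le Λ b (-1) 1
  have hb2 := abs_log_fieldZ_fixed_sub_le G hβ.le Λ (affCpl b u l) (-1) 1
  rw [abs_le] at hb1 hb2
  have hkey : β * (-l) * (Sp - Sm) ≤ β * (4 * (edgeBoundary G Λ).card) := by
    nlinarith [hb1.1, hb1.2, hb2.1, hb2.2, hplus, hminus]
  have h2 : (-l) * (Sp - Sm) ≤ 4 * (edgeBoundary G Λ).card := by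
    have hkey' : β * ((-l) * (Sp - Sm)) ≤ β * (4 * (edgeBoundary G Λ).card) := by
      rw [← mul_assoc]; exact hkey
    exact le_of_mul_le_mul_left hkey' hβ
  rw [le_div_iff₀ hpos]
  linarith

/-! ### The main theorem: `m⁺ = m⁻` at the sites carrying the auxiliary direction -/

/-- **Absence of phase coexistence from a uniform Lipschitz bound in an auxiliary field.** Let
`G`, `v` and `u ≥ 0` be invariant under a family of graph automorphisms `φᵢ` tiling the volumes
`Λₙ = ⋃_{i∈Bₙ} φᵢ(cell)` disjointly with `|∂ᵉΛₙ|/#Bₙ → 0`, and let `β > 0`. Suppose that for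
some `δ > 0` and `C` the `+` boundary condition sums in the field `s₀v + λu` satisfy
`∑_{k∈Λₙ} u_k (⟨σ_k⟩⁺_{Λₙ;s₀v} - ⟨σ_k⟩⁺_{Λₙ;s₀v+λu}) ≤ C · #Bₙ · (-λ)` for all `n` and
`λ ∈ [-δ, 0)`. Then at every site `c` of the cell with `u_c > 0`: for every `ε > 0` there is a
finite `Λ₀` with `⟨σ_c⟩⁺_{Λ;β,s₀v} - ⟨σ_c⟩⁻_{Λ;β,s₀v} ≤ ε` for all finite `Λ ⊇ Λ₀`. Proof: with
`M^± = ∑_{c∈cell} u_c m^±_c(s₀)`, tiling and periodicity give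
`#Bₙ (M⁺ - M⁻) ≤ ∑_{k∈Λₙ} u_k (⟨σ_k⟩⁺_{Λₙ} - ⟨σ_k⟩⁻_{Λₙ})`, which the Lipschitz hypothesis and
`sum_fieldExpect_affCpl_plus_sub_minus_le` bound by `C #Bₙ(-λ) + 4|∂ᵉΛₙ|/(-λ)`; letting `n → ∞`
and then `λ ↑ 0` gives `M⁺ ≤ M⁻`, and `m⁻_c ≤ m⁺_c` termwise forces `m⁺_c = m⁻_c` wherever
`u_c > 0` (Friedli–Velenik 2017, Theorem 3.34: uniqueness iff `∂ψ/∂h⁺ = ∂ψ/∂h⁻`).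
[cite: FriedliVelenik2017, Theorem 3.34 and Prop. 3.29] -/
theorem exists_volume_plusMag_sub_minusMag_le_of_lipschitz (hβ : 0 < β) {s₀ : ℝ}
    {ι : Type*} (φ : ι → V ≃ V) (hφG : ∀ i x y, (G.Adj (φ i x) (φ i y) ↔ G.Adj x y))
    (hφv : ∀ i x, v (φ i x) = v x) (u : V → ℝ) (hu : ∀ x, 0 ≤ u x)
    (hφu : ∀ i x, u (φ i x) = u x) (cell : Finset V) (B : ℕ → Finset ι) (Λ : ℕ → Finset V)
    (hΛ : ∀ n, Λ n = (B n).biUnion fun i => cell.map (φ i).toEmbedding)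
    (hdisj : ∀ n, (↑(B n) : Set ι).PairwiseDisjoint fun i => cell.map (φ i).toEmbedding)
    (hB : ∀ n, (B n).Nonempty)
    (hratio : Tendsto (fun n => ((edgeBoundary G (Λ n)).card : ℝ) / (B n).card) atTop (𝓝 0))
    {C δ : ℝ} (hδ : 0 < δ)
    (hLip : ∀ n (l : ℝ), -δ ≤ l → l < 0 →
      ∑ k ∈ Λ n, u k * fieldExpect G (Λ n) β (affCpl 0 v s₀) .plus (spinAt k) -
        ∑ k ∈ Λ n, u k * fieldExpect G (Λ n) β (affCpl (affCpl 0 v s₀) u l) .plus (spinAt k) ≤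
          C * (B n).card * (-l))
    {c : V} (hc : c ∈ cell) (huc : 0 < u c) {ε : ℝ} (hε : 0 < ε) :
    ∃ Λ₀ : Finset V, ∀ Λ' : Finset V, Λ₀ ⊆ Λ' →
      plusMag G β v Λ' c s₀ - minusMag G β v Λ' c s₀ ≤ ε := by
  set Mp : ℝ := ∑ c ∈ cell, u c * infPlusMag G β v c s₀ with hMp
  set Mm : ℝ := ∑ c ∈ cell, u c * supMinusMag G β v c s₀ with hMm
  -- Step 1: for every `n` and `λ ∈ [-δ, 0)`: `Mp - Mm ≤ C(-λ) + (4/(-λ)) |∂Λₙ|/#Bₙ`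
  have step1 : ∀ n (l : ℝ), -δ ≤ l → l < 0 →
      Mp - Mm ≤ C * (-l) + (4 / (-l)) * (((edgeBoundary G (Λ n)).card : ℝ) / (B n).card) := by
    intro n l hl1 hl2
    have hpos : 0 < -l := neg_pos.2 hl2
    have hcard : (0 : ℝ) < (B n).card := by exact_mod_cast (hB n).card_pos
    -- lower bound the `+` sum and upper bound the `-` sum by the tiled cell sums
    have hlow : ((B n).card : ℝ) * Mp ≤ ∑ k ∈ Λ n, u k * plusMag G β v (Λ n) k s₀ := by
      calc ((B n).card : ℝ) * Mp = ∑ _i ∈ B n, Mp := by rw [Finset.sum_const, nsmul_eq_mul]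
        _ = ∑ i ∈ B n, ∑ c ∈ cell, u (φ i c) * infPlusMag G β v (φ i c) s₀ := by
            refine Finset.sum_congr rfl fun i _ => Finset.sum_congr rfl fun c _ => ?_
            rw [hφu, infPlusMag_equiv (φ i) (hφG i) (hφv i)]
        _ = ∑ k ∈ Λ n, u k * infPlusMag G β v k s₀ := by
            rw [hΛ n, sum_tiled φ cell (B n) (hdisj n)]
        _ ≤ ∑ k ∈ Λ n, u k * plusMag G β v (Λ n) k s₀ := Finset.sum_le_sum fun k _ =>
            mul_le_mul_of_nonneg_left (infPlusMag_le_plusMag (Λ n) k s₀) (hu k)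
    have hup : ∑ k ∈ Λ n, u k * minusMag G β v (Λ n) k s₀ ≤ ((B n).card : ℝ) * Mm := by
      calc ∑ k ∈ Λ n, u k * minusMag G β v (Λ n) k s₀
          ≤ ∑ k ∈ Λ n, u k * supMinusMag G β v k s₀ := Finset.sum_le_sum fun k _ =>
            mul_le_mul_of_nonneg_left (minusMag_le_supMinusMag (Λ n) k s₀) (hu k)
        _ = ∑ i ∈ B n, ∑ c ∈ cell, u (φ i c) * supMinusMag G β v (φ i c) s₀ := by
            rw [hΛ n, sum_tiled φ cell (B n) (hdisj n)]
        _ = ∑ _i ∈ B n, Mm := by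
            refine Finset.sum_congr rfl fun i _ => Finset.sum_congr rfl fun c _ => ?_
            rw [hφu, supMinusMag_equiv (φ i) (hφG i) (hφv i)]
        _ = ((B n).card : ℝ) * Mm := by rw [Finset.sum_const, nsmul_eq_mul]
    -- the two finite-volume inputs
    have hL := hLip n l hl1 hl2
    have hS := sum_fieldExpect_affCpl_plus_sub_minus_le (G := G) hβ (Λ n) (affCpl 0 v s₀) u hl2
    have hsum : ∑ k ∈ Λ n, u k * plusMag G β v (Λ n) k s₀ -
        ∑ k ∈ Λ n, u k * minusMag G β v (Λ n) k s₀ ≤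
        C * (B n).card * (-l) + 4 * (edgeBoundary G (Λ n)).card / (-l) := by
      simp only [plusMag, minusMag]
      linarith
    have hmain : ((B n).card : ℝ) * (Mp - Mm) ≤
        C * (B n).card * (-l) + 4 * (edgeBoundary G (Λ n)).card / (-l) := by
      nlinarith [hlow, hup, hsum]
    -- divide by `#Bₙ`
    have hdiv : Mp - Mm ≤ (C * (B n).card * (-l) + 4 * (edgeBoundary G (Λ n)).card / (-l)) /
        (B n).card := by
      rw [le_div_iff₀ hcard]; linarith
    calc Mp - Mm ≤ (C * (B n).card * (-l) + 4 * (edgeBoundary G (Λ n)).card / (-l)) /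
          (B n).card := hdiv
      _ = C * (-l) + (4 / (-l)) * (((edgeBoundary G (Λ n)).card : ℝ) / (B n).card) := by
          field_simp
  -- Step 2: `n → ∞`: `Mp - Mm ≤ C(-λ)` for `λ ∈ [-δ, 0)`
  have step2 : ∀ l : ℝ, -δ ≤ l → l < 0 → Mp - Mm ≤ C * (-l) := by
    intro l hl1 hl2
    have hlim : Tendsto (fun n => C * (-l) +
        (4 / (-l)) * (((edgeBoundary G (Λ n)).card : ℝ) / (B n).card)) atTop (𝓝 (C * (-l))) := by
      simpa using (hratio.const_mul (4 / (-l))).const_add (C * (-l))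
    exact ge_of_tendsto' hlim fun n => step1 n l hl1 hl2
  -- Step 3: `λ ↑ 0`: `Mp ≤ Mm`
  have step3 : Mp ≤ Mm := by
    set sq : ℕ → ℝ := fun n => -(δ / ((n : ℝ) + 2)) with hsq
    have hsq_lt : ∀ n, sq n < 0 := fun n => by
      have : 0 < δ / ((n : ℝ) + 2) := by positivity
      simp only [hsq]; linarith
    have hsq_ge : ∀ n, -δ ≤ sq n := fun n => by
      simp only [hsq]
      have h2 : (2 : ℝ) ≤ (n : ℝ) + 2 := by linarith [(n.cast_nonneg : (0 : ℝ) ≤ n)]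
      have : δ / ((n : ℝ) + 2) ≤ δ / 2 := div_le_div_of_nonneg_left hδ.le (by norm_num) h2
      linarith
    have hbound : ∀ n, Mp - Mm ≤ C * (-(sq n)) := fun n => step2 (sq n) (hsq_ge n) (hsq_lt n)
    have hsq_tend : Tendsto (fun n => C * (-(sq n))) atTop (𝓝 0) := by
      have h1 : Tendsto (fun n : ℕ => δ / ((n : ℝ) + 2)) atTop (𝓝 0) := by
        have : Tendsto (fun n : ℕ => ((n : ℝ) + 2)) atTop atTop :=
          tendsto_atTop_add_const_right _ _ tendsto_natCast_atTop_atTop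
        exact tendsto_const_nhds.div_atTop this
      have h2 : Tendsto (fun n : ℕ => C * (δ / ((n : ℝ) + 2))) atTop (𝓝 (C * 0)) :=
        h1.const_mul C
      rw [mul_zero] at h2
      convert h2 using 2 with n
      simp [hsq]
    have := ge_of_tendsto' hsq_tend hbound
    linarith
  -- Step 4: termwise equality at `c`
  have step4 : infPlusMag G β v c s₀ = supMinusMag G β v c s₀ := by
    have hnn : ∀ c' ∈ cell, 0 ≤ u c' * (infPlusMag G β v c' s₀ - supMinusMag G β v c' s₀) :=
      fun c' _ => mul_nonneg (hu c') (sub_nonneg.2 (supMinusMag_le_infPlusMag hβ.le c' s₀))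
    have hsum : ∑ c' ∈ cell, u c' * (infPlusMag G β v c' s₀ - supMinusMag G β v c' s₀) = 0 := by
      refine le_antisymm ?_ (Finset.sum_nonneg hnn)
      have : ∑ c' ∈ cell, u c' * (infPlusMag G β v c' s₀ - supMinusMag G β v c' s₀) =
          Mp - Mm := by
        simp only [hMp, hMm, ← Finset.sum_sub_distrib]
        exact Finset.sum_congr rfl fun c' _ => by ring
      rw [this]; linarith
    have := (Finset.sum_eq_zero_iff_of_nonneg hnn).1 hsum c hc
    rcases mul_eq_zero.1 this with h | h
    · exact absurd h huc.ne'
    · linarith [supMinusMag_le_infPlusMag (G := G) (v := v) hβ.le c s₀]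
  -- Step 5: finite volumes approximating the infimum and the supremum
  obtain ⟨Λ₁, hΛ₁⟩ : ∃ Λ₁ : Finset V, plusMag G β v Λ₁ c s₀ < infPlusMag G β v c s₀ + ε / 2 :=
    exists_lt_of_ciInf_lt (f := fun Λ₁ : Finset V => plusMag G β v Λ₁ c s₀)
      (show infPlusMag G β v c s₀ < infPlusMag G β v c s₀ + ε / 2 by linarith)
  obtain ⟨Λ₂, hΛ₂⟩ : ∃ Λ₂ : Finset V, supMinusMag G β v c s₀ - ε / 2 < minusMag G β v Λ₂ c s₀ :=
    exists_lt_of_lt_ciSup (f := fun Λ₂ : Finset V => minusMag G β v Λ₂ c s₀)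
      (show supMinusMag G β v c s₀ - ε / 2 < supMinusMag G β v c s₀ by linarith)
  refine ⟨Λ₁ ∪ Λ₂, fun Λ' hΛ' => ?_⟩
  have h1 : plusMag G β v Λ' c s₀ ≤ plusMag G β v Λ₁ c s₀ :=
    plusMag_anti hβ.le (Finset.union_subset_left hΛ') c s₀
  have h2 : minusMag G β v Λ₂ c s₀ ≤ minusMag G β v Λ' c s₀ :=
    minusMag_mono hβ.le (Finset.union_subset_right hΛ') c s₀
  linarith

end Literature.Probability.LatticeModels

end
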